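import Summits.BirchSwinnertonDyer.Rank1Residual.X11b.Three.LambdaSupplyTransport
import Literature.NumberTheory.GaloisRepresentations.WeilLAdicCharacterProofs
import HarnessLib

/-!
# X11b @ `p = 3`, S24-a (λ-supply), part (C) continued: rank-one currency `e ∘ ψ`, avatars of
# products and inverses, and the anti-invariant quotient `ψ · (ψ ∘ θ)⁻¹`

HONEST FRAMING (cell `b2b-bsdres`, run/shared/lean/b2b/bsd-rank1-residual/, verbatim in every
file): the goal of the cell is to DELETE the COMBINATION-SHAPED residual classes of the
Birch–Swinnerton-Dyer formula for ALL analytic-rank `≤ 1` elliptic curves over `ℚ` — assembled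
STRICTLY from published theorems — so that the rank-`≤ 1` remainder becomes exactly the
CONSTRUCTION-SHAPED classes, which are TYPED, NOT attempted. This is not "finishing BSD". Team N8/O2
(X11b at `3`: `3 ‖ N`, `r_an = 1`, `E[3]` irreducible): research route; nothing booked; NO label
changes; O2 stays OPEN. THEOREMS ONLY (Galois bookkeeping over PROVED tree infrastructure); no
definition, no fact, no `sorry`.

PROVENANCE: sub-target S24 'λ-SUPPLY SPLIT' (OWNERS R7-59 / R7-66, lead x11b3 GEN 6; owner seat
`b2b-bsdres-x11b3-p7`), part **(C) "Transport"** of p7's feasibility census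
(`HOME/b2b-bsdres-x11b3-p7/s24/S24-FEASIBILITY.md` §2 (C)), taken as second hand by seat
`b2b-bsdres-x11b3-p2` (gen. 4; OWNERS offer row 2026-08-21T10:22Z). Sibling of part (E)
`X11b/Three/LambdaSupplyRankTwo.lean` (p260777), whose `θ`-currency
(`hθ : ∀ σ, res (θ σ) = c · res σ · c⁻¹`) and `hanti : g (θ σ) = (g σ)⁻¹` this file serves.

Sequel of `X11b/Three/LambdaSupplyTransport.lean` (§1 transport `isPAdicAvatarOf_galConj_outerConj`,
§2 quadratic case, §3 rigidity `eq_of_isPAdicAvatarOf`); same provenance (S24 part (C), seat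
`b2b-bsdres-x11b3-p2` gen. 4 as second hand of the S24 owner `b2b-bsdres-x11b3-p7`).

## What this file proves (`K/F` Galois number fields; every prime `p`; `ι : ℚ̄_p ≃ ℂ`;
## `e = FramedRep.unitsContinuousMulEquivOfUnique (Fin 1) ℚ̄_p : ℚ̄_pˣ ≃ GL₁(ℚ̄_p)`)

* §4 rank-one currency `e ∘ ψ`, `ψ : Γ_K →ₜ* ℚ̄_pˣ`, `e = FramedRep.unitsContinuousMulEquivOfUnique`:
  `isPAdicAvatarOf_unitsChar_iff` (the matrix layer removed), `comp_symm_comp_eq` (every rank-one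
  `r` is `e ∘ ψ`), `isPAdicAvatarOf_mul` / `isPAdicAvatarOf_inv` (avatars of `χ χ'`, `χ⁻¹` — with
  the honest side condition that `IsPAdicAvatarOf` is silent at ramified places of `χ`, so products
  need `χ`, `χ'` unramified where `χ χ'` is; automatic for characters unramified outside `p`).
* §5 `isPAdicAvatarOf_mul_galConj_inv[_of_res_eq]` (**THE QUOTIENT**): for `χ` unramified outside
  `p` with avatar `e ∘ ψ`, the avatar of `χ · (χ ∘ c̄)⁻¹` is `e ∘ (ψ · (ψ ∘ θ)⁻¹)`;
  CM currency `isPAdicAvatarOf_mul_galConj_complexConj_inv` (`χ · (χ ∘ complexConj)⁻¹`, the shape of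
  `HasInfinityType.galConj_complexConj`) and `isUnramifiedAt_mul_galConj[_complexConj]_inv_of_forall`
  (clause [11]: unramified outside `p`); `exists_isPAdicAvatarOf_unitsChar` (Weil's `exists_lAdic` in
  `e ∘ ψ` currency); `factorsThroughZp_unitsChar_iff`;
  `mul_comp_inv_apply_involutive`: `g = ψ · (ψ ∘ θ)⁻¹` satisfies `g(θ σ) = g(σ)⁻¹` when `θ² = id`
  (`absGaloisOuterConj_absGaloisOuterConj_of_mul_self` for `c² = 1`) — the `hanti` of (E)'s
  `apply_eq_one_of_anti`; and `apply_absGaloisOuterConj_eq_inv_of_isPAdicAvatarOf`: by rigidity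
  EVERY avatar of `χ · (χ ∘ c̄)⁻¹` is anti-invariant.

## References

* J.-P. Serre, *Abelian ℓ-adic representations and elliptic curves* (1968), Ch. I §2.1–2.3
  (unramified places, Frobenius, Chebotarev uniqueness), Ch. II §2.7. [SerreAbelianLadic1968]
* J. Neukirch, *Algebraic Number Theory* (1999), Ch. I §9 ((9.1)–(9.5): conjugate primes,
  decomposition / inertia groups and Frobenius under `τ`). [NeukirchANT1999]
* R. Greenberg, *Non-vanishing of certain values of `L`-functions*, Progr. Math. 70 (1987), §2
  (complex conjugation acting on characters of `Gal(K̃_∞/K)`; anticyclotomic = anti-invariant).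
  [Greenberg1987]
* F. Castella, M.-L. Hsieh, *Heegner cycles and `p`-adic `L`-functions*, Math. Ann. 370 (2018), §3.3
  (the `p`-adic avatar `φ̂` as a Galois character). [CastellaHsieh2018]
-/
noncomputable section

open scoped NumberField Polynomial
open NumberField IsDedekindDomain Field Polynomial
  Literature.NumberTheory.GaloisRepresentations Literature.NumberTheory.EllipticCurves
  Literature.NumberTheory.Automorphic

namespace Summit.BirchSwinnertonDyer.Rank1Residual.X11b.Three.LambdaSupply

/-! ### §4. Rank-one currency `e ∘ ψ`, `ψ : Γ_K →ₜ* ℚ̄_pˣ`: products, inverses, the quotient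
`ψ / (ψ ∘ θ)` and its anti-invariance -/

section RankOne

variable {K : Type} [Field K] [NumberField K] {p : ℕ} [Fact p.Prime]

omit [NumberField K] in
/-- Matrix entry of `e ∘ ψ`: `(e(ψ σ))₀₀ = ψ σ`. [folklore] -/
theorem unitsChar_apply_coe (ψ : absoluteGaloisGroup K →ₜ* (PadicAlgCl p)ˣ)
    (σ : absoluteGaloisGroup K) :
    ((((FramedRep.unitsContinuousMulEquivOfUnique (Fin 1) (PadicAlgCl p) : (PadicAlgCl p)ˣ →ₜ* GL (Fin 1) (PadicAlgCl p)).comp ψ σ : GL (Fin 1) (PadicAlgCl p)) : Matrix (Fin 1) (Fin 1) (PadicAlgCl p)) 0 0) =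
      ((ψ σ : (PadicAlgCl p)ˣ) : PadicAlgCl p) :=
  rfl

omit [NumberField K] in
/-- **Every rank-one framed representation is `e ∘ ψ`** for the character `ψ = e⁻¹ ∘ r`. [folklore] -/
theorem comp_symm_comp_eq (r : FramedGaloisRep K (PadicAlgCl p) 1) :
    (FramedRep.unitsContinuousMulEquivOfUnique (Fin 1) (PadicAlgCl p) : (PadicAlgCl p)ˣ →ₜ* GL (Fin 1) (PadicAlgCl p)).comp (((FramedRep.unitsContinuousMulEquivOfUnique (Fin 1) (PadicAlgCl p)).symm :
      GL (Fin 1) (PadicAlgCl p) →ₜ* (PadicAlgCl p)ˣ).comp r) = r :=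
  ContinuousMonoidHom.ext fun σ =>
    (FramedRep.unitsContinuousMulEquivOfUnique (Fin 1) (PadicAlgCl p)).apply_symm_apply (r σ)

omit [NumberField K] in
/-- `e ∘ ψ` is unramified at `v` iff `ψ` kills the inertia groups above `v`. [folklore] -/
theorem isUnramifiedAt_unitsChar_iff (ψ : absoluteGaloisGroup K →ₜ* (PadicAlgCl p)ˣ)
    (v : HeightOneSpectrum (𝓞 K)) :
    FramedGaloisRep.IsUnramifiedAt v ((FramedRep.unitsContinuousMulEquivOfUnique (Fin 1) (PadicAlgCl p) : (PadicAlgCl p)ˣ →ₜ* GL (Fin 1) (PadicAlgCl p)).comp ψ) ↔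
      ∀ 𝔓 ∈ v.primesAbove, ∀ σ ∈ 𝔓.inertia (absoluteGaloisGroup K), ψ σ = 1 := by
  refine forall₂_congr fun 𝔓 _ => forall₂_congr fun σ _ => ?_
  rw [ContinuousMonoidHom.coe_comp, Function.comp_apply]
  exact map_eq_one_iff _ (FramedRep.unitsContinuousMulEquivOfUnique (Fin 1) (PadicAlgCl p)).injective

/-- `e ∘ ψ` has Frobenius polynomial `X - a` at `v` iff `ψ(Φ) = a` for every arithmetic Frobenius
`Φ` above `v`. [folklore] -/
theorem hasFrobCharpolyAt_unitsChar_iff (ψ : absoluteGaloisGroup K →ₜ* (PadicAlgCl p)ˣ)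
    (v : HeightOneSpectrum (𝓞 K)) (a : PadicAlgCl p) :
    FramedGaloisRep.HasFrobCharpolyAt v (X - C a) ((FramedRep.unitsContinuousMulEquivOfUnique (Fin 1) (PadicAlgCl p) : (PadicAlgCl p)ˣ →ₜ* GL (Fin 1) (PadicAlgCl p)).comp ψ) ↔
      ∀ 𝔓 ∈ v.primesAbove, ∀ Φ : absoluteGaloisGroup K, IsArithFrobAt (𝓞 K) Φ 𝔓 →
        ((ψ Φ : (PadicAlgCl p)ˣ) : PadicAlgCl p) = a := by
  rw [FramedGaloisRep.hasFrobCharpolyAt_iff_of_rank_one]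
  rfl

/-- **`IsPAdicAvatarOf` in rank-one currency**: `e ∘ ψ` is the avatar of `χ` iff at every `v ∤ p`
where `χ` is unramified, `ψ` kills inertia and `ψ(Frob_v^{arith}) = ι⁻¹(χ(ϖ_v))⁻¹`. [folklore] -/
theorem isPAdicAvatarOf_unitsChar_iff (ι : PadicAlgCl p ≃+* ℂ) (χ : HeckeCharacter K)
    (ψ : absoluteGaloisGroup K →ₜ* (PadicAlgCl p)ˣ) :
    IsPAdicAvatarOf ι χ ((FramedRep.unitsContinuousMulEquivOfUnique (Fin 1) (PadicAlgCl p) : (PadicAlgCl p)ˣ →ₜ* GL (Fin 1) (PadicAlgCl p)).comp ψ) ↔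
      ∀ v : HeightOneSpectrum (𝓞 K), ((p : ℕ) : 𝓞 K) ∉ v.asIdeal → χ.IsUnramifiedAt v →
        (∀ 𝔓 ∈ v.primesAbove, ∀ σ ∈ 𝔓.inertia (absoluteGaloisGroup K), ψ σ = 1) ∧
        ∀ 𝔓 ∈ v.primesAbove, ∀ Φ : absoluteGaloisGroup K, IsArithFrobAt (𝓞 K) Φ 𝔓 →
          ((ψ Φ : (PadicAlgCl p)ˣ) : PadicAlgCl p) = (ι.symm (χ.valueAtUniformizer v))⁻¹ := by
  refine forall₃_congr fun v _ _ => ?_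
  rw [isUnramifiedAt_unitsChar_iff, hasFrobCharpolyAt_unitsChar_iff]

omit [NumberField K] in
/-- Pointwise inverse of a continuous character. [folklore] -/
theorem unitsChar_inv_apply (ψ : absoluteGaloisGroup K →ₜ* (PadicAlgCl p)ˣ)
    (σ : absoluteGaloisGroup K) : ψ⁻¹ σ = (ψ σ)⁻¹ := rfl

/-- **Avatars multiply.** If `e ∘ ψ`, `e ∘ ψ'` are the avatars of `χ`, `χ'`, then `e ∘ (ψ ψ')` is
the avatar of `χ χ'` — granted that at the places `v ∤ p` where `χ χ'` is unramified both `χ` and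
`χ'` are (automatic when `χ`, `χ'` are unramified outside `p`; in general `IsPAdicAvatarOf` says
nothing at the ramified places of `χ`). [folklore] -/
theorem isPAdicAvatarOf_mul (ι : PadicAlgCl p ≃+* ℂ) {χ χ' : HeckeCharacter K}
    {ψ ψ' : absoluteGaloisGroup K →ₜ* (PadicAlgCl p)ˣ} (h : IsPAdicAvatarOf ι χ ((FramedRep.unitsContinuousMulEquivOfUnique (Fin 1) (PadicAlgCl p) : (PadicAlgCl p)ˣ →ₜ* GL (Fin 1) (PadicAlgCl p)).comp ψ))
    (h' : IsPAdicAvatarOf ι χ' ((FramedRep.unitsContinuousMulEquivOfUnique (Fin 1) (PadicAlgCl p) : (PadicAlgCl p)ˣ →ₜ* GL (Fin 1) (PadicAlgCl p)).comp ψ'))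
    (hram : ∀ v : HeightOneSpectrum (𝓞 K), ((p : ℕ) : 𝓞 K) ∉ v.asIdeal →
      (χ * χ').IsUnramifiedAt v → χ.IsUnramifiedAt v ∧ χ'.IsUnramifiedAt v) :
    IsPAdicAvatarOf ι (χ * χ') ((FramedRep.unitsContinuousMulEquivOfUnique (Fin 1) (PadicAlgCl p) : (PadicAlgCl p)ˣ →ₜ* GL (Fin 1) (PadicAlgCl p)).comp (ψ * ψ')) := by
  rw [isPAdicAvatarOf_unitsChar_iff] at h h' ⊢
  intro v hpv hunr
  obtain ⟨hu, hu'⟩ := hram v hpv hunr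
  obtain ⟨h1, h2⟩ := h v hpv hu
  obtain ⟨h1', h2'⟩ := h' v hpv hu'
  refine ⟨fun 𝔓 h𝔓 σ hσ => ?_, fun 𝔓 h𝔓 Φ hΦ => ?_⟩
  · rw [ContinuousMonoidHom.mul_apply, h1 𝔓 h𝔓 σ hσ, h1' 𝔓 h𝔓 σ hσ, mul_one]
  · rw [ContinuousMonoidHom.mul_apply, Units.val_mul, h2 𝔓 h𝔓 Φ hΦ, h2' 𝔓 h𝔓 Φ hΦ,
      HeckeCharacter.valueAtUniformizer_mul', map_mul, mul_inv]

/-- **Avatars invert.** If `e ∘ ψ` is the avatar of `χ` then `e ∘ ψ⁻¹` is the avatar of `χ⁻¹`.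
[folklore] -/
theorem isPAdicAvatarOf_inv (ι : PadicAlgCl p ≃+* ℂ) {χ : HeckeCharacter K}
    {ψ : absoluteGaloisGroup K →ₜ* (PadicAlgCl p)ˣ} (h : IsPAdicAvatarOf ι χ ((FramedRep.unitsContinuousMulEquivOfUnique (Fin 1) (PadicAlgCl p) : (PadicAlgCl p)ˣ →ₜ* GL (Fin 1) (PadicAlgCl p)).comp ψ)) :
    IsPAdicAvatarOf ι χ⁻¹ ((FramedRep.unitsContinuousMulEquivOfUnique (Fin 1) (PadicAlgCl p) : (PadicAlgCl p)ˣ →ₜ* GL (Fin 1) (PadicAlgCl p)).comp ψ⁻¹) := by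
  rw [isPAdicAvatarOf_unitsChar_iff] at h ⊢
  intro v hpv hunr
  have hu : χ.IsUnramifiedAt v := by simpa only [inv_inv] using hunr.inv'
  obtain ⟨h1, h2⟩ := h v hpv hu
  refine ⟨fun 𝔓 h𝔓 σ hσ => ?_, fun 𝔓 h𝔓 Φ hΦ => ?_⟩
  · rw [unitsChar_inv_apply, h1 𝔓 h𝔓 σ hσ, inv_one]
  · rw [unitsChar_inv_apply, Units.val_inv_eq_inv_val, h2 𝔓 h𝔓 Φ hΦ,
      HeckeCharacter.valueAtUniformizer_inv', map_inv₀]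

omit [Fact p.Prime] in
/-- Unramified outside `p` is inherited by products. [folklore] -/
theorem hram_of_forall {χ χ' : HeckeCharacter K}
    (hχ : ∀ v : HeightOneSpectrum (𝓞 K), ((p : ℕ) : 𝓞 K) ∉ v.asIdeal → χ.IsUnramifiedAt v)
    (hχ' : ∀ v : HeightOneSpectrum (𝓞 K), ((p : ℕ) : 𝓞 K) ∉ v.asIdeal → χ'.IsUnramifiedAt v) :
    ∀ v : HeightOneSpectrum (𝓞 K), ((p : ℕ) : 𝓞 K) ∉ v.asIdeal →
      (χ * χ').IsUnramifiedAt v → χ.IsUnramifiedAt v ∧ χ'.IsUnramifiedAt v :=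
  fun v hpv _ => ⟨hχ v hpv, hχ' v hpv⟩

/-- **Existence of an avatar in rank-one currency (Weil 1956)**: an algebraic Hecke character has a
`p`-adic avatar `e ∘ ψ` (`HeckeCharacter.IsAlgebraic.exists_lAdic`, whose conclusion is
`IsPAdicAvatarOf` up to `ι⁻¹(χ(ϖ_v)⁻¹) = ι⁻¹(χ(ϖ_v))⁻¹` (`map_inv₀`), re-framed through
`comp_symm_comp_eq`). [cite: Weil1956, §1–§2] -/
theorem exists_isPAdicAvatarOf_unitsChar (ι : PadicAlgCl p ≃+* ℂ) {χ : HeckeCharacter K}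
    (hχ : χ.IsAlgebraic) :
    ∃ ψ : absoluteGaloisGroup K →ₜ* (PadicAlgCl p)ˣ, IsPAdicAvatarOf ι χ ((FramedRep.unitsContinuousMulEquivOfUnique (Fin 1) (PadicAlgCl p) : (PadicAlgCl p)ˣ →ₜ* GL (Fin 1) (PadicAlgCl p)).comp ψ) := by
  obtain ⟨r, hr⟩ := hχ.exists_lAdic ι
  exact ⟨((FramedRep.unitsContinuousMulEquivOfUnique (Fin 1) (PadicAlgCl p)).symm :
      GL (Fin 1) (PadicAlgCl p) →ₜ* (PadicAlgCl p)ˣ).comp r, by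
    rw [comp_symm_comp_eq]
    intro v hv hu
    obtain ⟨h1, h2⟩ := hr v hv hu
    -- Weil's file writes `ι⁻¹(χ(ϖ_v)⁻¹)`, `IsPAdicAvatarOf` writes `ι⁻¹(χ(ϖ_v))⁻¹`
    rw [map_inv₀] at h2
    exact ⟨h1, h2⟩⟩

omit [NumberField K] in
/-- **`FactorsThroughZp` in rank-one currency**: `e ∘ ψ` factors through `κ` iff `ψ` kills `ker κ` —
the conclusion shape `∀ σ, κ σ = 1 → g σ = 1` of (E)'s `LambdaSupply.apply_eq_one_of_anti`.
[folklore] -/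
theorem factorsThroughZp_unitsChar_iff (κ : ZpExtension K p)
    (ψ : absoluteGaloisGroup K →ₜ* (PadicAlgCl p)ˣ) :
    FactorsThroughZp κ ((FramedRep.unitsContinuousMulEquivOfUnique (Fin 1) (PadicAlgCl p) : (PadicAlgCl p)ˣ →ₜ* GL (Fin 1) (PadicAlgCl p)).comp ψ) ↔ ∀ σ : absoluteGaloisGroup K, κ σ = 1 → ψ σ = 1 := by
  refine forall₂_congr fun σ _ => ?_
  rw [ContinuousMonoidHom.coe_comp, Function.comp_apply]
  exact map_eq_one_iff _ (FramedRep.unitsContinuousMulEquivOfUnique (Fin 1) (PadicAlgCl p)).injective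

end RankOne

/-! ### §5. The quotient `χ / (χ ∘ τ̄)`: its avatar is `ψ / (ψ ∘ θ_τ)`, anti-invariant under an
involution, and so is EVERY avatar (rigidity) -/

section Quotient

variable {F K : Type} [Field F] [Field K] [NumberField K] [Algebra F K] [IsGalois F K]
  {p : ℕ} [Fact p.Prime]

/-- In rank-one currency the conjugate of `e ∘ ψ` by `τ` is `e ∘ (ψ ∘ θ_τ)`. [folklore] -/
theorem outerConj_unitsChar (τ : absoluteGaloisGroup F)
    (ψ : absoluteGaloisGroup K →ₜ* (PadicAlgCl p)ˣ) :
    FramedGaloisRep.outerConj τ ((FramedRep.unitsContinuousMulEquivOfUnique (Fin 1) (PadicAlgCl p) : (PadicAlgCl p)ˣ →ₜ* GL (Fin 1) (PadicAlgCl p)).comp ψ) = (FramedRep.unitsContinuousMulEquivOfUnique (Fin 1) (PadicAlgCl p) : (PadicAlgCl p)ˣ →ₜ* GL (Fin 1) (PadicAlgCl p)).comp (ψ.comp (absGaloisOuterConj F K τ)) :=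
  rfl

omit [IsGalois F K] [Fact p.Prime] in
/-- A Hecke character unramified outside `p` has all its conjugates `χ ∘ σ` unramified outside `p`.
[folklore] -/
theorem isUnramifiedAt_galConj_of_forall (σ : K ≃ₐ[F] K) {χ : HeckeCharacter K}
    (hχ : ∀ v : HeightOneSpectrum (𝓞 K), ((p : ℕ) : 𝓞 K) ∉ v.asIdeal → χ.IsUnramifiedAt v)
    (v : HeightOneSpectrum (𝓞 K)) (hpv : ((p : ℕ) : 𝓞 K) ∉ v.asIdeal) :
    (HeckeCharacter.galConj σ χ).IsUnramifiedAt v :=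
  (HeckeCharacter.isUnramifiedAt_galConj_iff σ χ v).2
    (hχ _ fun hm => hpv ((natCast_mem_smul_asIdeal_iff σ v p).1 hm))

omit [IsGalois F K] [Fact p.Prime] in
/-- The quotient `χ · (χ ∘ σ)⁻¹` of a character unramified outside `p` is unramified outside `p`
(the fourth clause of the λ-supply target for `λ = Ψ′ · (Ψ′ ∘ c)⁻¹`). [folklore] -/
theorem isUnramifiedAt_mul_galConj_inv_of_forall (σ : K ≃ₐ[F] K) {χ : HeckeCharacter K}
    (hχ : ∀ v : HeightOneSpectrum (𝓞 K), ((p : ℕ) : 𝓞 K) ∉ v.asIdeal → χ.IsUnramifiedAt v)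
    (v : HeightOneSpectrum (𝓞 K)) (hpv : ((p : ℕ) : 𝓞 K) ∉ v.asIdeal) :
    (χ * (HeckeCharacter.galConj σ χ)⁻¹).IsUnramifiedAt v :=
  (hχ v hpv).mul' (isUnramifiedAt_galConj_of_forall σ hχ v hpv).inv'

/-- **The avatar of the quotient `χ · (χ ∘ τ̄)⁻¹` is `ψ · (ψ ∘ θ_τ)⁻¹`**, for `χ` unramified outside
`p` with avatar `e ∘ ψ`. [folklore] -/
theorem isPAdicAvatarOf_mul_galConj_inv (ι : PadicAlgCl p ≃+* ℂ) {χ : HeckeCharacter K}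
    {ψ : absoluteGaloisGroup K →ₜ* (PadicAlgCl p)ˣ} (h : IsPAdicAvatarOf ι χ ((FramedRep.unitsContinuousMulEquivOfUnique (Fin 1) (PadicAlgCl p) : (PadicAlgCl p)ˣ →ₜ* GL (Fin 1) (PadicAlgCl p)).comp ψ))
    (hχ : ∀ v : HeightOneSpectrum (𝓞 K), ((p : ℕ) : 𝓞 K) ∉ v.asIdeal → χ.IsUnramifiedAt v)
    (τ : absoluteGaloisGroup F) :
    IsPAdicAvatarOf ι (χ * (HeckeCharacter.galConj (absGaloisQuot F K τ) χ)⁻¹)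
      ((FramedRep.unitsContinuousMulEquivOfUnique (Fin 1) (PadicAlgCl p) : (PadicAlgCl p)ˣ →ₜ* GL (Fin 1) (PadicAlgCl p)).comp (ψ * (ψ.comp (absGaloisOuterConj F K τ))⁻¹)) := by
  have hc : IsPAdicAvatarOf ι (HeckeCharacter.galConj (absGaloisQuot F K τ) χ)
      ((FramedRep.unitsContinuousMulEquivOfUnique (Fin 1) (PadicAlgCl p) : (PadicAlgCl p)ˣ →ₜ* GL (Fin 1) (PadicAlgCl p)).comp (ψ.comp (absGaloisOuterConj F K τ))) := by
    rw [← outerConj_unitsChar]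
    exact isPAdicAvatarOf_galConj_outerConj ι h τ
  refine isPAdicAvatarOf_mul ι h (isPAdicAvatarOf_inv ι hc) (hram_of_forall hχ fun v hpv => ?_)
  exact (isUnramifiedAt_galConj_of_forall _ hχ v hpv).inv'

omit [NumberField K] [Algebra F K] [IsGalois F K] in
/-- **Anti-invariance of the quotient**: if `θ` is an involution then `g = ψ · (ψ ∘ θ)⁻¹`
satisfies `g(θ σ) = g(σ)⁻¹`. [folklore] -/
theorem mul_comp_inv_apply_involutive {θ : absoluteGaloisGroup K →ₜ* absoluteGaloisGroup K}
    (hθθ : ∀ σ, θ (θ σ) = σ) (ψ : absoluteGaloisGroup K →ₜ* (PadicAlgCl p)ˣ)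
    (σ : absoluteGaloisGroup K) :
    (ψ * (ψ.comp θ)⁻¹) (θ σ) = ((ψ * (ψ.comp θ)⁻¹) σ)⁻¹ := by
  rw [ContinuousMonoidHom.mul_apply, ContinuousMonoidHom.mul_apply, unitsChar_inv_apply,
    unitsChar_inv_apply, ContinuousMonoidHom.coe_comp, Function.comp_apply, Function.comp_apply, hθθ,
    mul_inv_rev, inv_inv, mul_comm]

/-- **The quotient avatar in the `θ`-currency of part (E).** `K/F` Galois, `c ∈ Γ_F`, `θ` the lift of
conjugation by `c` (`res (θ σ) = c · res σ · c⁻¹`), `χ` a Hecke character of `K` unramified outside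
`p` with avatar `e ∘ ψ`. Then `e ∘ (ψ · (ψ ∘ θ)⁻¹)` is the avatar of `χ · (χ ∘ c̄)⁻¹`, and if
`c² = 1` the character `g = ψ · (ψ ∘ θ)⁻¹` is anti-invariant: `g(θ σ) = g(σ)⁻¹` — the
hypothesis `hanti` of `LambdaSupply.apply_eq_one_of_anti`. [folklore] -/
theorem isPAdicAvatarOf_mul_galConj_inv_of_res_eq (ι : PadicAlgCl p ≃+* ℂ) {χ : HeckeCharacter K}
    {ψ : absoluteGaloisGroup K →ₜ* (PadicAlgCl p)ˣ} (h : IsPAdicAvatarOf ι χ ((FramedRep.unitsContinuousMulEquivOfUnique (Fin 1) (PadicAlgCl p) : (PadicAlgCl p)ˣ →ₜ* GL (Fin 1) (PadicAlgCl p)).comp ψ))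
    (hχ : ∀ v : HeightOneSpectrum (𝓞 K), ((p : ℕ) : 𝓞 K) ∉ v.asIdeal → χ.IsUnramifiedAt v)
    {c : absoluteGaloisGroup F} {θ : absoluteGaloisGroup K →ₜ* absoluteGaloisGroup K}
    (hθ : ∀ σ, absGaloisRestrict F K (θ σ) = c * absGaloisRestrict F K σ * c⁻¹) :
    IsPAdicAvatarOf ι (χ * (HeckeCharacter.galConj (absGaloisQuot F K c) χ)⁻¹)
      ((FramedRep.unitsContinuousMulEquivOfUnique (Fin 1) (PadicAlgCl p) : (PadicAlgCl p)ˣ →ₜ* GL (Fin 1) (PadicAlgCl p)).comp (ψ * (ψ.comp θ)⁻¹)) := by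
  rw [eq_absGaloisOuterConj_of_res_eq hθ]
  exact isPAdicAvatarOf_mul_galConj_inv ι h hχ c

/-- **The quotient avatar, quadratic form** (`F = ℚ`, `[K : ℚ] = 2`, `c ∈ Γ_ℚ ∖ res(Γ_K)`, `θ` the
lift of conjugation by `c`, `σ ≠ 1` THE non-trivial automorphism of `K` — complex conjugation when
`K` is imaginary): for `χ` unramified outside `p` with avatar `e ∘ ψ`, the avatar of
`χ · (χ ∘ σ)⁻¹` is `e ∘ (ψ · (ψ ∘ θ)⁻¹)`. [folklore] -/
theorem isPAdicAvatarOf_mul_galConj_inv_of_finrank_eq_two {K : Type} [Field K] [NumberField K]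
    [IsGalois ℚ K] (hK : Module.finrank ℚ K = 2) (ι : PadicAlgCl p ≃+* ℂ) {χ : HeckeCharacter K}
    {ψ : absoluteGaloisGroup K →ₜ* (PadicAlgCl p)ˣ} (h : IsPAdicAvatarOf ι χ ((FramedRep.unitsContinuousMulEquivOfUnique (Fin 1) (PadicAlgCl p) : (PadicAlgCl p)ˣ →ₜ* GL (Fin 1) (PadicAlgCl p)).comp ψ))
    (hχ : ∀ v : HeightOneSpectrum (𝓞 K), ((p : ℕ) : 𝓞 K) ∉ v.asIdeal → χ.IsUnramifiedAt v)
    {c : absoluteGaloisGroup ℚ} (hc : c ∉ Set.range (absGaloisRestrict ℚ K))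
    {θ : absoluteGaloisGroup K →ₜ* absoluteGaloisGroup K}
    (hθ : ∀ σ, absGaloisRestrict ℚ K (θ σ) = c * absGaloisRestrict ℚ K σ * c⁻¹)
    {σ : K ≃ₐ[ℚ] K} (hσ : σ ≠ 1) :
    IsPAdicAvatarOf ι (χ * (HeckeCharacter.galConj σ χ)⁻¹) ((FramedRep.unitsContinuousMulEquivOfUnique (Fin 1) (PadicAlgCl p) : (PadicAlgCl p)ˣ →ₜ* GL (Fin 1) (PadicAlgCl p)).comp (ψ * (ψ.comp θ)⁻¹)) := by
  rw [← absGaloisQuot_eq_of_not_mem_range hK hc hσ]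
  exact isPAdicAvatarOf_mul_galConj_inv_of_res_eq ι h hχ hθ

/-- **The quotient avatar, CM form** (the currency of `HasInfinityType.galConj_complexConj`): for
`K` an imaginary quadratic CM field, `c ∈ Γ_ℚ ∖ res(Γ_K)` with lift `θ`, and `χ` unramified outside
`p` with avatar `e ∘ ψ`, the avatar of `χ · (χ ∘ complexConj)⁻¹` is `e ∘ (ψ · (ψ ∘ θ)⁻¹)`.
[folklore] -/
theorem isPAdicAvatarOf_mul_galConj_complexConj_inv {K : Type} [Field K] [NumberField K]
    [IsGalois ℚ K] [IsCMField K] (hK : Module.finrank ℚ K = 2) (ι : PadicAlgCl p ≃+* ℂ)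
    {χ : HeckeCharacter K} {ψ : absoluteGaloisGroup K →ₜ* (PadicAlgCl p)ˣ}
    (h : IsPAdicAvatarOf ι χ ((FramedRep.unitsContinuousMulEquivOfUnique (Fin 1) (PadicAlgCl p) : (PadicAlgCl p)ˣ →ₜ* GL (Fin 1) (PadicAlgCl p)).comp ψ))
    (hχ : ∀ v : HeightOneSpectrum (𝓞 K), ((p : ℕ) : 𝓞 K) ∉ v.asIdeal → χ.IsUnramifiedAt v)
    {c : absoluteGaloisGroup ℚ} (hc : c ∉ Set.range (absGaloisRestrict ℚ K))
    {θ : absoluteGaloisGroup K →ₜ* absoluteGaloisGroup K}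
    (hθ : ∀ σ, absGaloisRestrict ℚ K (θ σ) = c * absGaloisRestrict ℚ K σ * c⁻¹) :
    IsPAdicAvatarOf ι (χ * (HeckeCharacter.galConj (IsCMField.complexConj K) χ)⁻¹)
      ((FramedRep.unitsContinuousMulEquivOfUnique (Fin 1) (PadicAlgCl p) : (PadicAlgCl p)ˣ →ₜ* GL (Fin 1) (PadicAlgCl p)).comp (ψ * (ψ.comp θ)⁻¹)) := by
  rw [← galConj_restrictScalars (F₀ := ℚ), ← absGaloisQuot_eq_restrictScalars_complexConj hK hc]
  exact isPAdicAvatarOf_mul_galConj_inv_of_res_eq ι h hχ hθ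

omit [Fact p.Prime] in
/-- Clause [11] in CM currency: `χ · (χ ∘ complexConj)⁻¹` is unramified outside `p` when `χ` is.
[folklore] -/
theorem isUnramifiedAt_mul_galConj_complexConj_inv_of_forall {K : Type} [Field K] [NumberField K]
    [IsCMField K] {χ : HeckeCharacter K}
    (hχ : ∀ v : HeightOneSpectrum (𝓞 K), ((p : ℕ) : 𝓞 K) ∉ v.asIdeal → χ.IsUnramifiedAt v)
    (v : HeightOneSpectrum (𝓞 K)) (hpv : ((p : ℕ) : 𝓞 K) ∉ v.asIdeal) :
    (χ * (HeckeCharacter.galConj (IsCMField.complexConj K) χ)⁻¹).IsUnramifiedAt v := by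
  rw [← galConj_restrictScalars (F₀ := ℚ)]
  exact isUnramifiedAt_mul_galConj_inv_of_forall (F := ℚ) _ hχ v hpv

/-- The lift of conjugation by an involution `c` is an involution (`IndexTwo.conjHom_conjHom` in
`absGaloisOuterConj` currency). [folklore] -/
theorem absGaloisOuterConj_absGaloisOuterConj_of_mul_self {c : absoluteGaloisGroup F}
    (hc2 : c * c = 1) (σ : absoluteGaloisGroup K) :
    absGaloisOuterConj F K c (absGaloisOuterConj F K c σ) = σ := by
  rw [← absGaloisOuterConj_mul_apply, hc2, absGaloisOuterConj_one_apply]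

/-- **Every avatar of `χ · (χ ∘ c̄)⁻¹` is anti-invariant** (`c² = 1`, `χ` unramified outside `p`
and possessing an avatar): by rigidity (`eq_of_isPAdicAvatarOf`) any avatar `r` equals
`e ∘ (ψ · (ψ ∘ θ_c)⁻¹)`, so `r(θ_c σ) = r(σ)⁻¹`. [folklore] -/
theorem apply_absGaloisOuterConj_eq_inv_of_isPAdicAvatarOf (ι : PadicAlgCl p ≃+* ℂ)
    {χ : HeckeCharacter K} {r₀ : FramedGaloisRep K (PadicAlgCl p) 1} (h₀ : IsPAdicAvatarOf ι χ r₀)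
    (hχ : ∀ v : HeightOneSpectrum (𝓞 K), ((p : ℕ) : 𝓞 K) ∉ v.asIdeal → χ.IsUnramifiedAt v)
    {c : absoluteGaloisGroup F} (hc2 : c * c = 1) {r : FramedGaloisRep K (PadicAlgCl p) 1}
    (hr : IsPAdicAvatarOf ι (χ * (HeckeCharacter.galConj (absGaloisQuot F K c) χ)⁻¹) r)
    (σ : absoluteGaloisGroup K) :
    r (absGaloisOuterConj F K c σ) = (r σ)⁻¹ := by
  -- write `r₀ = e ∘ ψ`
  set ψ : absoluteGaloisGroup K →ₜ* (PadicAlgCl p)ˣ :=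
    ((FramedRep.unitsContinuousMulEquivOfUnique (Fin 1) (PadicAlgCl p)).symm :
      GL (Fin 1) (PadicAlgCl p) →ₜ* (PadicAlgCl p)ˣ).comp r₀ with hψ
  have h₀' : IsPAdicAvatarOf ι χ ((FramedRep.unitsContinuousMulEquivOfUnique (Fin 1) (PadicAlgCl p) : (PadicAlgCl p)ˣ →ₜ* GL (Fin 1) (PadicAlgCl p)).comp ψ) := by rwa [hψ, comp_symm_comp_eq]
  have hq := isPAdicAvatarOf_mul_galConj_inv ι h₀' hχ c
  have heq := eq_of_isPAdicAvatarOf ι hq hr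
  rw [heq, ContinuousMonoidHom.coe_comp, Function.comp_apply, Function.comp_apply,
    mul_comp_inv_apply_involutive (absGaloisOuterConj_absGaloisOuterConj_of_mul_self hc2) ψ σ, map_inv]

end Quotient

end Summit.BirchSwinnertonDyer.Rank1Residual.X11b.Three.LambdaSupply

end
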